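import Mathlib

/-!
# `RationalPeriodQuarter` — coefficientwise `ℚ`-linear projection of complex polynomials (child A, lemma L3, algebra)

Support for `RationalPeriodQuarter.HeckeFieldOfCruxes` (stmt-Langlands-10432), seed node `HeckeFieldOfCruxesSplit`,
child A `RationalFormsInjectivity`.  The projection lemma (`PR_ℂ = PR_ℚ ⊗_ℚ ℂ` coefficientwise) rests on a
`ℚ`-linear functional `π : ℂ →ₗ[ℚ] ℚ` applied to the coefficients of a complex polynomial (`rpqProj π P`):
it is additive, `ℚ[X]`-semilinear (`rpqProj_mul_map`), commutes with evaluation at rational points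
(`rpqProj_eval_ratCast`), and is independent of the fraction representing a function near a point
(`rpqProj_frac_wellDefined`).  Also: dual functionals for a `ℚ`-independent family (`rpq_exists_dual`) and two
finiteness facts for real Möbius maps.  Mathlib only.
-/

set_option linter.dupNamespace false

namespace Summit.Langlands.Langlands.Theorems

open scoped BigOperators
open Polynomial

/-- Coefficientwise application of a `ℚ`-linear functional `π : ℂ → ℚ` (recast into `ℂ`) to a complex polynomial. -/
noncomputable def rpqProj (π : ℂ →ₗ[ℚ] ℚ) (P : ℂ[X]) : ℂ[X] :=
  ∑ i ∈ Finset.range (P.natDegree + 1), Polynomial.C ((π (P.coeff i) : ℚ) : ℂ) * Polynomial.X ^ i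

/-- Coefficients of the projection. -/
theorem rpqProj_coeff (π : ℂ →ₗ[ℚ] ℚ) (P : ℂ[X]) (k : ℕ) :
    (rpqProj π P).coeff k = ((π (P.coeff k) : ℚ) : ℂ) := by
  rw [rpqProj, finsetSum_coeff]
  simp only [coeff_C_mul_X_pow]
  rw [Finset.sum_ite_eq]
  by_cases hk : k ∈ Finset.range (P.natDegree + 1)
  · rw [if_pos hk]
  · rw [if_neg hk]
    have : P.coeff k = 0 := by
      rw [Finset.mem_range, not_lt] at hk
      exact Polynomial.coeff_eq_zero_of_natDegree_lt (by omega)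
    rw [this, map_zero, Rat.cast_zero]

/-- The projection does not raise the degree. -/
theorem rpqProj_natDegree_le (π : ℂ →ₗ[ℚ] ℚ) (P : ℂ[X]) :
    (rpqProj π P).natDegree ≤ P.natDegree := by
  rw [natDegree_le_iff_coeff_eq_zero]
  intro N hN
  rw [rpqProj_coeff, Polynomial.coeff_eq_zero_of_natDegree_lt hN, map_zero, Rat.cast_zero]

/-- Additivity. -/
theorem rpqProj_add (π : ℂ →ₗ[ℚ] ℚ) (P P' : ℂ[X]) :
    rpqProj π (P + P') = rpqProj π P + rpqProj π P' := by
  ext k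
  simp only [rpqProj_coeff, coeff_add, map_add, Rat.cast_add]

/-- Negation. -/
theorem rpqProj_neg (π : ℂ →ₗ[ℚ] ℚ) (P : ℂ[X]) : rpqProj π (-P) = -rpqProj π P := by
  ext k
  simp only [rpqProj_coeff, coeff_neg, map_neg, Rat.cast_neg]

/-- Subtraction. -/
theorem rpqProj_sub (π : ℂ →ₗ[ℚ] ℚ) (P P' : ℂ[X]) :
    rpqProj π (P - P') = rpqProj π P - rpqProj π P' := by
  rw [sub_eq_add_neg, rpqProj_add, rpqProj_neg, ← sub_eq_add_neg]

/-- `π (z * q) = q * π z` for rational `q`. -/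
theorem rpq_pi_mul_ratCast (π : ℂ →ₗ[ℚ] ℚ) (z : ℂ) (q : ℚ) : π (z * (q : ℂ)) = q * π z := by
  have : z * (q : ℂ) = q • z := by rw [Rat.smul_def, mul_comm]
  rw [this, map_smul, smul_eq_mul]

/-- `ℚ[X]`-semilinearity: the projection commutes with multiplication by a rational polynomial. -/
theorem rpqProj_mul_map (π : ℂ →ₗ[ℚ] ℚ) (P : ℂ[X]) (Q : ℚ[X]) :
    rpqProj π (P * Q.map (algebraMap ℚ ℂ)) = rpqProj π P * Q.map (algebraMap ℚ ℂ) := by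
  ext k
  simp only [rpqProj_coeff, coeff_mul, coeff_map, map_sum, Rat.cast_sum, eq_ratCast]
  refine Finset.sum_congr rfl fun x _ => ?_
  rw [rpq_pi_mul_ratCast, Rat.cast_mul, mul_comm]

/-- A constant times a rational polynomial projects to the projected constant times the polynomial. -/
theorem rpqProj_C_mul_map (π : ℂ →ₗ[ℚ] ℚ) (z : ℂ) (Q : ℚ[X]) :
    rpqProj π (Polynomial.C z * Q.map (algebraMap ℚ ℂ)) = Polynomial.C ((π z : ℚ) : ℂ) * Q.map (algebraMap ℚ ℂ) := by
  rw [rpqProj_mul_map]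
  congr 1
  ext k
  simp only [rpqProj_coeff, coeff_C]
  split_ifs <;> simp

/-- The projection commutes with evaluation at a rational point. -/
theorem rpqProj_eval_ratCast (π : ℂ →ₗ[ℚ] ℚ) (P : ℂ[X]) (t : ℚ) :
    ((π (P.eval (t : ℂ)) : ℚ) : ℂ) = (rpqProj π P).eval (t : ℂ) := by
  have hn : (rpqProj π P).natDegree < P.natDegree + 1 :=
    Nat.lt_succ_of_le (rpqProj_natDegree_le π P)
  rw [eval_eq_sum_range (p := P), eval_eq_sum_range' hn, map_sum, Rat.cast_sum]
  refine Finset.sum_congr rfl fun i _ => ?_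
  rw [rpqProj_coeff, ← Rat.cast_pow, rpq_pi_mul_ratCast, Rat.cast_mul, Rat.cast_pow, mul_comm]

/-- The projection commutes with "evaluate at a rational point and divide by a rational". -/
theorem rpqProj_eval_div_ratCast (π : ℂ →ₗ[ℚ] ℚ) (P : ℂ[X]) (t q : ℚ) :
    ((π (P.eval (t : ℂ) / (q : ℂ)) : ℚ) : ℂ) = (rpqProj π P).eval (t : ℂ) / (q : ℂ) := by
  rw [div_eq_mul_inv, ← Rat.cast_inv, rpq_pi_mul_ratCast, Rat.cast_mul, Rat.cast_inv, rpqProj_eval_ratCast,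
    mul_comm, ← div_eq_mul_inv]

/-- WELL-DEFINEDNESS.  Two fractions `P/Q`, `P'/Q'` (`Q, Q'` rational) agreeing on an infinite set of points where the
denominators do not vanish have projections agreeing as cross-multiplied polynomials. -/
theorem rpqProj_frac_wellDefined (π : ℂ →ₗ[ℚ] ℚ) (P P' : ℂ[X]) (Q Q' : ℚ[X]) (S : Set ℂ) (hS : S.Infinite)
    (h : ∀ s ∈ S, (Q.map (algebraMap ℚ ℂ)).eval s ≠ 0 ∧ (Q'.map (algebraMap ℚ ℂ)).eval s ≠ 0 ∧
      P.eval s / (Q.map (algebraMap ℚ ℂ)).eval s = P'.eval s / (Q'.map (algebraMap ℚ ℂ)).eval s) :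
    rpqProj π P * Q'.map (algebraMap ℚ ℂ) = rpqProj π P' * Q.map (algebraMap ℚ ℂ) := by
  have hD : P * Q'.map (algebraMap ℚ ℂ) - P' * Q.map (algebraMap ℚ ℂ) = 0 := by
    apply eq_zero_of_infinite_isRoot
    refine hS.mono fun s hs => ?_
    obtain ⟨hQ, hQ', heq⟩ := h s hs
    simp only [Set.mem_setOf_eq, IsRoot.def, eval_sub, eval_mul]
    rw [div_eq_div_iff hQ hQ'] at heq
    rw [heq, sub_self]
  have hD' : P * Q'.map (algebraMap ℚ ℂ) = P' * Q.map (algebraMap ℚ ℂ) := sub_eq_zero.1 hD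
  rw [← rpqProj_mul_map, hD', rpqProj_mul_map]

/-- DUAL FUNCTIONALS.  A `ℚ`-linearly independent finite family in `ℂ` admits `ℚ`-linear coordinate functionals. -/
theorem rpq_exists_dual {n : ℕ} (e : Fin n → ℂ) (he : LinearIndependent ℚ e) :
    ∃ π : Fin n → (ℂ →ₗ[ℚ] ℚ), ∀ l l' : Fin n, π l (e l') = if l' = l then 1 else 0 := by
  classical
  obtain ⟨g, hg⟩ := LinearMap.exists_extend he.repr
  refine ⟨fun l => (Finsupp.lapply l).comp g, fun l l' => ?_⟩
  have hmem : e l' ∈ Submodule.span ℚ (Set.range e) := Submodule.subset_span ⟨l', rfl⟩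
  have h1 : g (e l') = he.repr ⟨e l', hmem⟩ := by
    have := congrArg (fun φ => φ ⟨e l', hmem⟩) hg
    simpa using this
  rw [LinearMap.comp_apply, h1, he.repr_eq_single l' ⟨e l', hmem⟩ rfl, Finsupp.lapply_apply,
    Finsupp.single_apply]

/-- Applying the `l`-th dual functional to a rational combination `∑ e_{l'} r_{l'}` returns `r_l`. -/
theorem rpq_dual_combination {n : ℕ} (e : Fin n → ℂ) (π : Fin n → (ℂ →ₗ[ℚ] ℚ))
    (hπ : ∀ l l' : Fin n, π l (e l') = if l' = l then 1 else 0) (r : Fin n → ℚ) (l : Fin n) :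
    π l (∑ l', e l' * (r l' : ℂ)) = r l := by
  rw [map_sum]
  simp only [rpq_pi_mul_ratCast, hπ]
  simp [Finset.sum_ite_eq']

/-- An affine equation `α t + β = 0` with `(α, β) ≠ (0, 0)` has finitely many real solutions. -/
theorem rpq_finite_affine (α β : ℝ) (h : α ≠ 0 ∨ β ≠ 0) : Set.Finite {t : ℝ | α * t + β = 0} := by
  apply Set.Subsingleton.finite
  intro t ht t' ht'
  simp only [Set.mem_setOf_eq] at ht ht'
  rcases h with hα | hβ
  · have : α * t = α * t' := by linarith
    exact mul_left_cancel₀ hα this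
  · by_cases hα : α = 0
    · exfalso; apply hβ; simpa [hα] using ht
    · have : α * t = α * t' := by linarith
      exact mul_left_cancel₀ hα this

/-- A real Möbius map of determinant one (with Lean's junk value at the pole) has finite fibres. -/
theorem rpq_finite_moebius_fibre (a b c d : ℝ) (hdet : a * d - b * c = 1) (r : ℝ) :
    Set.Finite {t : ℝ | (a * t + b) / (c * t + d) = r} := by
  have h1 : Set.Finite {t : ℝ | c * t + d = 0} := by
    apply rpq_finite_affine
    by_contra h
    push Not at h
    obtain ⟨hc, hd⟩ := h
    rw [hc, hd] at hdet
    norm_num at hdet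
  have h2 : Set.Finite {t : ℝ | (a - r * c) * t + (b - r * d) = 0} := by
    apply rpq_finite_affine
    by_contra h
    push Not at h
    obtain ⟨hα, hβ⟩ := h
    have ha : a = r * c := by linarith
    have hb : b = r * d := by linarith
    rw [ha, hb] at hdet
    nlinarith
  refine (h1.union h2).subset fun t ht => ?_
  simp only [Set.mem_setOf_eq, Set.mem_union] at ht ⊢
  by_cases hct : c * t + d = 0
  · exact Or.inl hct
  · right
    rw [div_eq_iff hct] at ht
    linarith

end Summit.Langlands.Langlands.Theorems
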